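import Mathlib
import HarnessLib
import Summits.HubbardSuperconductivity.HubbardSuperconductivity.Theorems.KLProgrammeKLRegimeSplitSpin01

/-!
# Route `KLProgramme` — crux K3 `KLRegimeTwoPointLimit` (stmt-HubbardSuperconductivity-19937): Δ15 — the leg-dressing CONSTANT restaged
# (`legDressBarQ`, `PairLadderStepAtV5`, `PairValueIncrementAtV5`, `QuarticValueIncrementAtS2`, `EngineBoundsAtV5S`, `PairArrayAtV2`,
# `BetaSplitAtS2`; cell gate-hubbard-kl, seat p1 = C1 lead, g5)

WHY (HOME/p1/CHILD1-SKELETON.md §6, STATUS p1 g5 13:52Z).  The external-leg insertion at step `n` — tree (quartic vertex) —`C_n(ℓ)`— (two-leg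
vertex), joining line on an external leg `ℓ` of the pair amplitude — contributes `ζ_n(ℓ)·𝒞_{n−1}(k,k′)`, `ζ_n(ℓ) = C_n(ℓ)·Σ^V_{n−1}(ℓ)`,
nonzero only for `ℓ` in the slice-`n` window (`legSliceCount`).  Its residual-LOCAL-PART piece is known to the engine only through
`RenormalisedAtF … R (n−1)` (in the history): `≈ κ·cr·U²·4^{−n}` per crossing leg — QUADRATIC with the `R`-LEVEL constant `cr`; its slope piece is
`O(|U|³)` with engine constants.  (ii) `PairLadderStepAtV4` bounds the leg part by the `G/P`-level `legDressBar G P U c = G.CF·(P.Klam·U)²·c`, which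
`EngineP3 = ∃G ∀P ∀R ∃Q …` cannot certify for every admissible `R` at the top scales.  The engine-certifiable majorant is `Q`-LEVEL (`Q` is chosen
after `R`): **`legDressBarQ G P Q U n c := Q.CR·((P.Klam·U)²·(4^n)⁻¹ + (P.Klam·|U|)³)·c`**.  (ii′) Child 1's pair-array deviation then carries
`κ₀·Q.CR·Klam²·U²`, which the `P`-level tolerance `P.C_W·U²` of `PairArrayAt` cannot dominate (`BetaSplitP = ∀G ∃P ∀Q …`); the repair (M3) is a
`Q`-AWARE tolerance with a FIXED numeral: **`PairArrayAtV2`: `‖𝒞_n(k,k′) − u‖ ≤ (P.C_W + klLegKappa·Q.CR·P.Klam³)·U²`**, `klLegKappa := 4000`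
(child 1 USES `Q.CR`, never dominates it; every consumer pays the `Q`-part with its `U₀`/`c₀`, which come after `Q` in `BetaSplitP`,
`EngineP3`, `TwoPointAssemblyP3`).  No quantifier restaging, no record change.

CONTENTS: the three V4/S engine clauses with `legDressBar ↦ legDressBarQ` (`PairLadderStepAtV5`, `PairValueIncrementAtV5`,
`QuarticValueIncrementAtS2`), `EngineBoundsAtV5S` (= `EngineBoundsAtV4S` with those three), `PairArrayAtV2`, `BetaSplitAtS2 := PairArrayAtV2 ∧
EndpointLineS ∧ FirstMoments`; bookkeeping `legDressBarQ_nonneg`, `pairArrayAtV2_of_pairArrayAt`, `betaSplitAtS2_of_S`.  A bundle binding them takes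
`engine := EngineBoundsAtV5S`, `split := BetaSplitAtS2` and the comparison-frame history `BetaSplitAtS2 ∧ RenormalisedAtF ∧ EngineBoundsAtV5S`
(typist of record).  Definitions only; nothing is asserted about the model.
-/

noncomputable section

namespace Summit.HubbardSuperconductivity.HubbardSuperconductivity.Theorems.KLRegimeSplit

set_option linter.dupNamespace false -- summit = problem name (single-conjunct summit), D-0017

open Real Finset Literature.MathematicalPhysics.QuantumLattice Literature.Probability.LatticeModels
open Summit.HubbardSuperconductivity.HubbardSuperconductivity.Theorems.KLProgrammeLegKernels

/-! ## §1 The restaged majorant and the numeral -/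

/-- **`Q`-level leg-dressing majorant** `legDressBarQ G P Q U n c := Q.CR·((P.Klam·U)²·(4^n)⁻¹ + (P.Klam·|U|)³)·c`: the quadratic part carries the
top-scale profile `4^{-n}` (residual-local-part insertions, `R`-dependent size certified through `Q.CR ≥ κ·cr`), the cubic part the slope
insertions. (`G` is not read; kept for the slot-uniform argument order.) -/
def legDressBarQ (_G : GeoConsts) (P : SplitConsts) (Q : EngConsts) (U : ℝ) (n c : ℕ) : ℝ :=
  Q.CR * ((P.Klam * U) ^ 2 * ((4 : ℝ) ^ n)⁻¹ + (P.Klam * |U|) ^ 3) * c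

/-- **The fixed numeral `κ₀ = 4000`** of the `Q`-aware pair-array tolerance (an upper bound for the row-0′ propagation constant times the
scale sums `Σ_n 4^{-n}·legSliceCount`, `Σ_n legSliceCount ≤ 20`; a numeral, so that no constant record has to know it). -/
def klLegKappa : ℝ := 4000

/-- `legDressBarQ ≥ 0` when `Q.CR ≥ 0` and `Klam ≥ 0`. -/
theorem legDressBarQ_nonneg (G : GeoConsts) {P : SplitConsts} {Q : EngConsts} (hK : 0 ≤ P.Klam) (hQ : 0 ≤ Q.CR) (U : ℝ) (n c : ℕ) :
    0 ≤ legDressBarQ G P Q U n c := by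
  unfold legDressBarQ
  have h1 : 0 ≤ (P.Klam * U) ^ 2 * ((4 : ℝ) ^ n)⁻¹ := by positivity
  have h2 : 0 ≤ (P.Klam * |U|) ^ 3 := pow_nonneg (mul_nonneg hK (abs_nonneg U)) 3
  exact mul_nonneg (mul_nonneg hQ (add_nonneg h1 h2)) (Nat.cast_nonneg c)

/-! ## §2 The engine clauses, v5 (leg majorant restaged) -/

section Model

variable (L M : ℕ) [NeZero L] [NeZero M]

/-- **(E2-v5) one pair-ladder step per scale** — `PairLadderStepAtV4` with `legDressBar ↦ legDressBarQ … n`. -/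
def PairLadderStepAtV5 (G : GeoConsts) (P : SplitConsts) (Q : EngConsts) (β U μ : ℝ) (K : TrigPolyC4v) (n : ℕ) : Prop :=
  (n = 0 → ∀ Qm : TorusSite 2 L, ∀ k ∈ klBall L μ K, ∀ k' ∈ klBall L μ K,
      ‖klPairAmplitude L M β U μ K 0 Qm k k' - (U : ℂ)‖ ≤ initDevBar G U) ∧
  (1 ≤ n → ∀ Qm : TorusSite 2 L, IsPairClassAt L Qm n →
      ∃ w : TorusSite 2 L → ℝ, (∀ p, 0 ≤ w p) ∧ (∑ p, w p ≤ G.bhi) ∧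
        ∃ N : Matrix (TorusSite 2 L) (TorusSite 2 L) ℂ,
          (1 + Matrix.diagonal (fun p => (w p : ℂ)) * klPairArray L M β U μ K (n - 1) Qm) * N = 1 ∧
          ∀ k ∈ klBall L μ K, ∀ k' ∈ klBall L μ K,
            ‖klPairAmplitude L M β U μ K n Qm k k' - (klPairArray L M β U μ K (n - 1) Qm * N) k k'‖ ≤
              drivePBar G P U (n - 1) + eremBar G P Q U β L (n - 1) + thermalBar G P U β n +
                legDressBarQ G P Q U n (legSliceCount L μ K n ![k', Qm - k', Qm - k, k]))

/-- **(E2″-v5) value increments of the pair arrays** — `PairValueIncrementAtV4` with `legDressBar ↦ legDressBarQ … n`. -/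
def PairValueIncrementAtV5 (G : GeoConsts) (P : SplitConsts) (Q : EngConsts) (β U μ : ℝ) (K : TrigPolyC4v) (n : ℕ) : Prop :=
  1 ≤ n → ∀ Qm : TorusSite 2 L, ∀ k ∈ klBall L μ K, ∀ k' ∈ klBall L μ K,
    ‖klPairAmplitude L M β U μ K n Qm k k' - klPairAmplitude L M β U μ K (n - 1) Qm k k'‖ ≤
      gainBar G P U n (klTorusNorm L Qm) (klTorusNorm L (k - k')) (klTorusNorm L (k + k' - Qm)) +
        eremBar G P Q U β L (n - 1) + thermalBar G P U β n +
          legDressBarQ G P Q U n (legSliceCount L μ K n ![k', Qm - k', Qm - k, k])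

/-- **(E2′-S2) pointwise increments of the `↑↓` running coupling values at the true transfers** — `QuarticValueIncrementAtS` with
`legDressBar ↦ legDressBarQ … n`. -/
def QuarticValueIncrementAtS2 (G : GeoConsts) (P : SplitConsts) (Q : EngConsts) (β U μ : ℝ) (K : TrigPolyC4v) (n : ℕ) : Prop :=
  1 ≤ n → ∀ k₁ ∈ klBall L μ K, ∀ k₂ ∈ klBall L μ K, ∀ k₃ ∈ klBall L μ K,
    ‖klQuarticValue L M β U μ K n 0 1 k₁ k₂ k₃ - klQuarticValue L M β U μ K (n - 1) 0 1 k₁ k₂ k₃‖ ≤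
      gainBar G P U n (klTorusNorm L (k₁ + k₃)) (klTorusNorm L (k₁ - k₂)) (klTorusNorm L (k₂ - k₃)) +
        eremBar G P Q U β L (n - 1) + thermalBar G P U β n +
          legDressBarQ G P Q U n (legSliceCount L μ K n ![k₁, k₂, k₃, k₁ - k₂ + k₃])

/-- **`EngineBoundsAtV5S … G P Q K n`** = `EngineBoundsAtV4S` with the three leg-carrying clauses restaged:
(E0) ∧ (E1-v4) ∧ (E2-v5) ∧ (E2″-v5) ∧ (E2′-S2) ∧ (E2′-S UV) ∧ (E4) ∧ (E5-S).  Same slot type as `Preds.engine`. -/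
def EngineBoundsAtV5S (G : GeoConsts) (P : SplitConsts) (Q : EngConsts) (β U μ : ℝ) (K : TrigPolyC4v) (n : ℕ) : Prop :=
  SelfEnergySymmetric L M β U μ K n ∧ KernelNormsV4 L M P Q β U μ K n ∧
    PairLadderStepAtV5 L M G P Q β U μ K n ∧ PairValueIncrementAtV5 L M G P Q β U μ K n ∧
      QuarticValueIncrementAtS2 L M G P Q β U μ K n ∧ QuarticValueUVAtS L M G β U μ K n ∧
        EngineFirstMoments L M G P Q β U μ K n ∧ IsoTupleL1AtS L M G P β U μ K n

/-! ## §3 The split clause, v2 (`Q`-aware tolerance) -/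

/-- **(B1-v2′) the pair arrays are constant on the ball up to a `Q`-AWARE tolerance**: for every total momentum `Qm` there is
`u ∈ [0, 2|U|]` with `|𝒞_n(k,k′) − u| ≤ (P.C_W + klLegKappa·Q.CR·P.Klam³)·U²` for `k, k′` in the ball. -/
def PairArrayAtV2 (P : SplitConsts) (Q : EngConsts) (β U μ : ℝ) (K : TrigPolyC4v) (n : ℕ) : Prop :=
  ∀ Qm : TorusSite 2 L,
    ∃ u : ℝ, 0 ≤ u ∧ u ≤ 2 * |U| ∧ ∀ k ∈ klBall L μ K, ∀ k' ∈ klBall L μ K,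
      ‖klPairAmplitude L M β U μ K n Qm k k' - (u : ℂ)‖ ≤ (P.C_W + klLegKappa * Q.CR * P.Klam ^ 3) * U ^ 2

/-- **`BetaSplitAtS2 … G P Q K n`** := `PairArrayAtV2 ∧ EndpointLineS ∧ FirstMoments`.  Same slot type as `Preds.split`; `G` is not read. -/
def BetaSplitAtS2 (_G : GeoConsts) (P : SplitConsts) (Q : EngConsts) (β U μ : ℝ) (K : TrigPolyC4v) (n : ℕ) : Prop :=
  PairArrayAtV2 L M P Q β U μ K n ∧ EndpointLineS L M P β U μ K n ∧ FirstMoments L M P β U μ K n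

/-! ## §4 Bookkeeping -/

/-- The v1 pair-array clause implies the `Q`-aware one when `Q.CR ≥ 0` and `Klam ≥ 0` (the tolerance only grows). -/
theorem pairArrayAtV2_of_pairArrayAt {P : SplitConsts} {Q : EngConsts} (hCR : 0 ≤ Q.CR) (hK : 0 ≤ P.Klam) {β U μ : ℝ}
    {K : TrigPolyC4v} {n : ℕ} (h : PairArrayAt L M P β U μ K n) : PairArrayAtV2 L M P Q β U μ K n := by
  intro Qm
  obtain ⟨u, hu0, hu2, hball⟩ := h Qm
  refine ⟨u, hu0, hu2, fun k hk k' hk' => (hball k hk k' hk').trans ?_⟩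
  have hκ : 0 ≤ klLegKappa * Q.CR * P.Klam ^ 3 := by unfold klLegKappa; positivity
  nlinarith [sq_nonneg U]

/-- `BetaSplitAtS ⇒ BetaSplitAtS2` when `Q.CR ≥ 0` and `Klam ≥ 0`. -/
theorem betaSplitAtS2_of_S {G : GeoConsts} {P : SplitConsts} {Q : EngConsts} (hCR : 0 ≤ Q.CR) (hK : 0 ≤ P.Klam) {β U μ : ℝ}
    {K : TrigPolyC4v} {n : ℕ} (h : BetaSplitAtS L M G P Q β U μ K n) : BetaSplitAtS2 L M G P Q β U μ K n :=
  ⟨pairArrayAtV2_of_pairArrayAt L M hCR hK h.1, h.2.1, h.2.2⟩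

end Model

end Summit.HubbardSuperconductivity.HubbardSuperconductivity.Theorems.KLRegimeSplit

end
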